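import Summits.CriticalPhenomena.PercolationContinuityZ3.Theorems.FK.Transplant.KNFreeSlabSteps
import HarnessLib

/-!
# FRONTIER TRANSPLANT, binder 2 (TP_FK) — T4-SLAB (L3): straight segments, membership in lane regions, ROUTE T4 (inner,
# direct) and FACE BOXES (the part of the look box beyond a face of the level box, inside the lane slab)

Support file (`--supports stmt-CriticalPhenomena-4575`, helper) of the FRONTIER TRANSPLANT sub-cell (`fk-continuity/transplant/`,
seat `prim-bschramm-fkt-p1`); builds on p205010 (kernel theorem, internal audit signed; external expert review pending).
0 definitions · 0 named facts · 0 sorries · standard axioms. File 5/18 of the bytes-first package (R60 (3)(β)) of the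
UNFUNDED memo row `T4-SLAB [g122, R60]` (re-described R62 (E)); proposable only on a coordinator ruling.
Registered R63 (cell INBOX l.4709, 2026-08-23); registry row T4s; lead label T4s-05 (fkt-lead L22, l.4677).

HONEST FRAMING (page 1, cell rule). The transplant's theorem of record `ufsc0_of_freeBoundaryHypothesis_r3` (p248245) is
CONDITIONAL on FH AND on TP_FK = `KNFreeTargetHittable d q p`, both OPEN at the same `p` for `q > 1` near `p_c(q)` (⇔ GRC Conj.
(5.103) via K1; barrier note `Literature.Barriers.CriticalPhenomena.SamePFreeBoundaryCriteria`, FBN-01, cited first); the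
transplant is a typed reduction, not a proof of FK continuity. THIS FILE: straight segments of explicit edges inside a lane region, membership lemmas for lane regions / look boxes /
the frozen collar, ROUTE T4 (`inner_direct_route`: inner contact, the lane target lies in the interior of the level
box — collar crossing at the exit, plate steps in the interior), and FACE BOXES (`faceBox_subset_laneRegion`,
`mem_faceBox`, `faceBox_wide`). It proves nothing about either binder and says nothing at `p ↓ p_c(q)`; NOT `_r4`; `_r3` « 2 / 0 ☑ », n_open = 2,
BINDER-OWNERS, FO-19 NO-GO unchanged.

Declarations: `pow_le_fkLaw_restrW_real_openConnIn_segment`, `mem_laneRegion`, `mem_Qset_of_forall`,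
`not_mem_of_face`, `not_mem_of_interior`, `inner_direct_route`, `faceBox_subset_laneRegion`, `mem_faceBox`,
`faceBox_wide`.

References: G. Grimmett, *The Random-Cluster Model*, Springer 2006, Thm. (3.1) eq. (3.4), Thm. (3.7), Thm. (3.8), Thm. (3.21)
eq. (3.22), Lemma (4.13), §5.7 [Grimmett2006]; G. Kozma, S. Nitzan, arXiv:2401.12397 (2024), §4 Lemma 10 Step IV (pp. 19–21) [KozmaNitzan2024].
-/

noncomputable section

namespace Summit.CriticalPhenomena.PercolationContinuityZ3.Theorems.FK

open MeasureTheory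
open scoped ENNReal Classical
open Literature.Probability.Percolation Literature.Probability.LatticeModels SimpleGraph
open Literature.Probability.Percolation.GadgetSystem Literature.Probability.Percolation.KozmaNitzan Transplant
open Literature.Barriers.CriticalPhenomena

variable {d : ℕ}

/-! ### (P1) v5 — straight segments of explicit edges; membership in lane regions -/

/-- **A straight segment of explicit edges**: the `n + 1` collinear points `x[f ↦ α₀ + τ j]`, `j ≤ n` (`τ = ±1`), all in
`R`, are joined inside `R` with free-law probability `≥ p̃^n`. The gate columns and sheet crossings of the lanes.
[cite: Grimmett2006, Thm. (3.1) eq. (3.4), Thm. (3.8)] -/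
theorem pow_le_fkLaw_restrW_real_openConnIn_segment {q : ℝ} (hq : 1 ≤ q) (p : unitInterval) (R : Finset (Site d))
    (x : Site d) (f : Fin d) (α₀ τ : ℤ) (hτ : τ = 1 ∨ τ = -1) (n : ℕ)
    (hmem : ∀ j : ℕ, j ≤ n → Function.update x f (α₀ + τ * j) ∈ R) :
    ((p : ℝ) / (p + q * (1 - p))) ^ n ≤ (fkLaw R (restrW (↑R : Set (Site d)) (lattW d p)) q).real
      (openConnIn (↑R : Set (Site d)) (Function.update x f α₀) (Function.update x f (α₀ + τ * n))) := by
  have hq0 : 0 < q := one_pos.trans_le hq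
  haveI : IsProbabilityMeasure (fkLaw R (restrW (↑R : Set (Site d)) (lattW d p)) q) :=
    isProbabilityMeasure_fkLaw _ _ hq0
  have hπ0 : 0 ≤ (p : ℝ) / (p + q * (1 - p)) := div_nonneg p.2.1 (by nlinarith [p.2.1, p.2.2, hq0])
  induction n with
  | zero =>
    have h0 : Function.update x f (α₀ + τ * ((0 : ℕ) : ℤ)) = Function.update x f α₀ := by simp
    rw [h0, pow_zero]
    have hx0 : Function.update x f α₀ ∈ (↑R : Set (Site d)) := by
      have := hmem 0 le_rfl; rw [h0] at this; exact Finset.mem_coe.2 this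
    have huniv : (openConnIn (↑R : Set (Site d)) (Function.update x f α₀) (Function.update x f α₀) :
        Set (BondConfig (Site d))) = Set.univ := by
      ext ω; simp only [Set.mem_univ, iff_true]; exact ⟨hx0, hx0, SimpleGraph.Reachable.refl _⟩
    rw [huniv, probReal_univ]
  | succ n ih =>
    have ih' := ih fun j hj => hmem j (Nat.le_succ_of_le hj)
    have hadj : (zdGraph d).Adj (Function.update x f (α₀ + τ * (n : ℕ)))
        (Function.update x f (α₀ + τ * ((n + 1 : ℕ) : ℤ))) := by
      refine zdGraph_adj_of_eq_off f (fun j hj => by simp [Function.update_of_ne hj]) ?_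
      simp only [Function.update_self]
      push_cast
      rcases hτ with h | h <;> rw [h]
      · left; ring
      · right; ring
    have hstep := ratio_le_fkLaw_restrW_real_openConnIn_edge hq p R (hmem n (Nat.le_succ n)) (hmem (n + 1) le_rfl) hadj
    rw [pow_succ]
    exact mul_le_fkLaw_real_openConnIn_trans R _ hq _ _ _ _ (pow_nonneg hπ0 n) ih' hstep

/-- Membership in a lane region `(U ∩ slab) ∖ (S ∖ {z, w})`. [folklore] -/
theorem mem_laneRegion {U S : Finset (Site d)} {c : Fin d} {ζ : ℤ} {L : ℕ} {z w x : Site d}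
    (hxU : x ∈ U) (hxc : |x c - ζ| ≤ (L : ℤ)) (hxS : x ∉ S ∨ x = z ∨ x = w) :
    x ∈ (U.filter fun x => |x c - ζ| ≤ (L : ℤ)) \ (S \ {z, w}) := by
  rw [Finset.mem_sdiff, Finset.mem_filter, Finset.mem_sdiff, Finset.mem_insert, Finset.mem_singleton]
  refine ⟨⟨hxU, hxc⟩, ?_⟩
  rcases hxS with h | h
  · exact fun h' => h h'.1
  · exact fun h' => h'.2 h

/-- Membership in the look box `v + ℓQ_g`, coordinatewise. [folklore] -/
theorem mem_Qset_of_forall {g : Geom d} {ℓ : ℕ} {v x : Site d}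
    (hx : ∀ b, v b + ℓ * g.loQ b ≤ x b ∧ x b ≤ v b + ℓ * g.hiQ b) : x ∈ g.Qset ℓ v := by
  rw [Geom.Qset, mem_Icc_iff]
  intro b
  simpa only [Pi.add_apply, Pi.smul_apply, smul_eq_mul] using hx b

/-- A frozen set inside `Icc (Lo+1) (Hi-1)` misses every point at or beyond a face: if `yf` is the `(f, τ)`-face
coordinate (`Hi f` or `Lo f`) and `0 ≤ τ (x_f - yf)` then `x ∉ S`. [folklore] -/
theorem not_mem_of_face {S : Finset (Site d)} {Lo Hi : Site d} (hS : S ⊆ Finset.Icc (Lo + 1) (Hi - 1))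
    {f : Fin d} {τ yf : ℤ} (hface : (τ = 1 ∧ yf = Hi f) ∨ (τ = -1 ∧ yf = Lo f)) {x : Site d}
    (hx : 0 ≤ τ * (x f - yf)) : x ∉ S := by
  intro hxS
  have := (mem_Icc_iff.1 (hS hxS)) f
  simp only [Pi.add_apply, Pi.sub_apply, Pi.one_apply] at this
  rcases hface with ⟨hτ, hy⟩ | ⟨hτ, hy⟩
  · rw [hτ, hy] at hx; linarith
  · rw [hτ, hy] at hx; linarith

/-- A frozen set missing the interior `Icc (Lo+T+1) (Hi-T-1)` misses every point of it. [folklore] -/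
theorem not_mem_of_interior {S : Finset (Site d)} {Lo Hi : Site d} {T : ℕ}
    (hSint : ∀ x ∈ S, x ∉ Finset.Icc (Lo + ((T : Site d) + 1)) (Hi - ((T : Site d) + 1))) {x : Site d}
    (hx : ∀ b, Lo b + T + 1 ≤ x b ∧ x b ≤ Hi b - T - 1) : x ∉ S := by
  intro hxS
  refine hSint x hxS (mem_Icc_iff.2 fun b => ?_)
  simp only [Pi.add_apply, Pi.sub_apply, Pi.natCast_apply, Pi.one_apply]
  constructor <;> linarith [hx b]

/-! ### (P1) v5 — ROUTE T4 (inner, direct): the lane target lies in the interior of the level box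

Exit `z` on layer `T` of the face `(i, σ)` (`z_i = yi - σT`), one explicit edge inward to `x₁ = z - σe_i` (depth
`T+1`, in the interior `INT = Icc (Lo+T+1) (Hi-T-1)`, unfrozen), then ONE slab box
`I = INT ∩ U ∩ slab = Icc loI hiI` to the target `t ∈ (v + ℓF_g) ∩ I` (supplied by the caller with its side
conditions: the case analysis). -/

/-- **Route T4 (inner, direct).** With `N ≥ L`, `m` such that the interior slab box `I` (corners `loI, hiI` below)
is `2N`-fat off the slab direction, contains `x₁` and `t`, and `|x₁ - t|_b ≤ m N` (`b ≠ c`), `|ζ - t_c| ≤ m L`: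
`p̃ · β^{d m} ≤ φ^free_R(z ↔ t in R)`, `R = (U ∩ slab) ∖ (S ∖ {z})`.
[cite: KozmaNitzan2024, §4 Lemma 10 Step IV (pp. 19–21); Grimmett2006, Thm. (3.1) eq. (3.4), Thm. (3.8), eq. (3.22), §5.7 eq. (5.102)] -/
theorem inner_direct_route {q : ℝ} (hq : 1 ≤ q) (p : unitInterval) (hd : 3 ≤ d) {L : ℕ}
    {β : ℝ} (hβ0 : 0 ≤ β) (hβ1 : β ≤ 1)
    (hβ : ∀ (N : ℕ) (g : zdGraph d ≃g zdGraph d) (u z : Site d), u ∈ fkSlab d L N → z ∈ fkSlab d L N →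
      β ≤ (fkLaw ((fkSlab d L N).image g) (restrW (↑((fkSlab d L N).image g) : Set (Site d)) (lattW d p)) q).real
        (openConnIn (↑((fkSlab d L N).image g) : Set (Site d)) (g u) (g z)))
    (Lo Hi : Site d) (i : Fin d) (σ yi : ℤ) (hface : (σ = 1 ∧ yi = Hi i) ∨ (σ = -1 ∧ yi = Lo i))
    (T : ℕ) (v : Site d)
    (S : Finset (Site d)) (hSint : ∀ x ∈ S, x ∉ Finset.Icc (Lo + ((T : Site d) + 1)) (Hi - ((T : Site d) + 1)))
    (ℓ : ℕ) (g : Geom d) (c : Fin d) (hci : c ≠ i)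
    (z : Site d) (ζ : ℤ) (hzi : z i = yi - σ * T) (hzc : z c = ζ)
    (hzQ : z ∈ g.Qset ℓ v)
    (N m : ℕ) (hLN : L ≤ N) (hm1 : 1 ≤ m)
    -- the interior slab box `I = Icc loI hiI`, `loI/hiI` spelled out, its fatness, and that it holds `x₁`
    (hfat : ∀ b, b ≠ c → max (Lo b + T + 1) (v b + ℓ * g.loQ b) + 2 * (N : ℤ) ≤ min (Hi b - T - 1) (v b + ℓ * g.hiQ b))
    (hslabQ : v c + ℓ * g.loQ c ≤ ζ - L ∧ ζ + L ≤ v c + ℓ * g.hiQ c)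
    (hslabIn : Lo c + T + 1 ≤ ζ - L ∧ ζ + L ≤ Hi c - T - 1)
    (hx1 : ∀ b, b ≠ c → max (Lo b + T + 1) (v b + ℓ * g.loQ b) ≤ Function.update z i (yi - σ * ((T : ℤ) + 1)) b ∧
      Function.update z i (yi - σ * ((T : ℤ) + 1)) b ≤ min (Hi b - T - 1) (v b + ℓ * g.hiQ b))
    -- the target `t` (and the second allowed frozen vertex `w` of the region, not used by this route)
    (t w : Site d) (htc : |t c - ζ| ≤ (L : ℤ))
    (htI : ∀ b, b ≠ c → max (Lo b + T + 1) (v b + ℓ * g.loQ b) ≤ t b ∧ t b ≤ min (Hi b - T - 1) (v b + ℓ * g.hiQ b))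
    (hdist : ∀ b, b ≠ c → |Function.update z i (yi - σ * ((T : ℤ) + 1)) b - t b| ≤ (m : ℤ) * N) :
    ((p : ℝ) / (p + q * (1 - p))) * β ^ (d * m) ≤
      (fkLaw (((g.Qset ℓ v).filter fun x => |x c - ζ| ≤ (L : ℤ)) \ (S \ {z, w}))
        (restrW (↑(((g.Qset ℓ v).filter fun x => |x c - ζ| ≤ (L : ℤ)) \ (S \ {z, w})) : Set (Site d))
          (lattW d p)) q).real
      (openConnIn (↑(((g.Qset ℓ v).filter fun x => |x c - ζ| ≤ (L : ℤ)) \ (S \ {z, w})) : Set (Site d)) z t) := by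
  have hq0 : 0 < q := one_pos.trans_le hq
  have hd2 : 2 ≤ d := by omega
  set R := ((g.Qset ℓ v).filter fun x => |x c - ζ| ≤ (L : ℤ)) \ (S \ {z, w}) with hR
  haveI : IsProbabilityMeasure (fkLaw R (restrW (↑R : Set (Site d)) (lattW d p)) q) :=
    isProbabilityMeasure_fkLaw _ _ hq0
  have hσ1 : σ = 1 ∨ σ = -1 := hface.elim (fun h => Or.inl h.1) (fun h => Or.inr h.1)
  set x1 : Site d := Function.update z i (yi - σ * ((T : ℤ) + 1)) with hx1def
  have hL0 : |ζ - ζ| ≤ (L : ℤ) := by rw [sub_self, abs_zero]; positivity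
  -- the interior slab box
  set loI : Site d := fun b => if b = c then ζ - L else max (Lo b + T + 1) (v b + ℓ * g.loQ b) with hloI
  set hiI : Site d := fun b => if b = c then ζ + L else min (Hi b - T - 1) (v b + ℓ * g.hiQ b) with hhiI
  have hIsub : Finset.Icc loI hiI ⊆ R := by
    intro x hx
    rw [mem_Icc_iff] at hx
    have hxc : |x c - ζ| ≤ (L : ℤ) := by
      have := hx c; simp only [hloI, hhiI, if_true] at this; rw [abs_le]; constructor <;> linarith
    have hxb : ∀ b, b ≠ c → max (Lo b + T + 1) (v b + ℓ * g.loQ b) ≤ x b ∧ x b ≤ min (Hi b - T - 1) (v b + ℓ * g.hiQ b) :=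
      fun b hb => by have := hx b; simp only [hloI, hhiI, if_neg hb] at this; exact this
    refine mem_laneRegion (mem_Qset_of_forall fun b => ?_) hxc (Or.inl (not_mem_of_interior hSint fun b => ?_))
    · by_cases hb : b = c
      · rw [hb]; rw [abs_le] at hxc; constructor <;> linarith [hslabQ.1, hslabQ.2]
      · have h := hxb b hb
        exact ⟨(le_max_right _ _).trans h.1, h.2.trans (min_le_right _ _)⟩
    · by_cases hb : b = c
      · rw [hb]; rw [abs_le] at hxc; constructor <;> linarith [hslabIn.1, hslabIn.2]
      · have h := hxb b hb
        exact ⟨(le_max_left _ _).trans h.1, h.2.trans (min_le_left _ _)⟩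
  have hwideI : ∀ b, loI b + 2 * (L : ℤ) ≤ hiI b := by
    intro b
    by_cases hb : b = c
    · simp only [hloI, hhiI, if_pos hb]; linarith
    · simp only [hloI, hhiI, if_neg hb]
      have := hfat b hb; have hLN' : (L : ℤ) ≤ N := by exact_mod_cast hLN
      linarith
  have hfatI : ∀ b, b ≠ c → loI b + 2 * (N : ℤ) ≤ hiI b := by
    intro b hb; simp only [hloI, hhiI, if_neg hb]; exact hfat b hb
  have hx1I : x1 ∈ Finset.Icc loI hiI := by
    rw [mem_Icc_iff]; intro b
    by_cases hb : b = c
    · simp only [hloI, hhiI, if_pos hb]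
      rw [hb, hx1def, Function.update_of_ne hci, hzc]; constructor <;> linarith
    · simp only [hloI, hhiI, if_neg hb]; exact hx1 b hb
  have htI' : t ∈ Finset.Icc loI hiI := by
    rw [mem_Icc_iff]; intro b
    by_cases hb : b = c
    · simp only [hloI, hhiI, if_pos hb]; rw [hb]; rw [abs_le] at htc; constructor <;> linarith [htc.1, htc.2]
    · simp only [hloI, hhiI, if_neg hb]; exact htI b hb
  have hx1R : x1 ∈ R := hIsub hx1I
  have hzR : z ∈ R := mem_laneRegion hzQ (by rw [hzc]; exact hL0) (Or.inr (Or.inl rfl))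
  have hadj : (zdGraph d).Adj z x1 := by
    refine zdGraph_adj_of_eq_off i (fun j hj => by rw [hx1def, Function.update_of_ne hj]) ?_
    rw [hx1def, Function.update_self, hzi]
    rcases hσ1 with hσ | hσ <;> rw [hσ]
    · right; ring
    · left; ring
  have hdc : |x1 c - t c| ≤ (m : ℤ) * L := by
    rw [hx1def, Function.update_of_ne hci, hzc, abs_sub_comm]
    refine htc.trans ?_
    have : (1 : ℤ) * L ≤ m * L := mul_le_mul_of_nonneg_right (by exact_mod_cast hm1) (Nat.cast_nonneg L)
    linarith
  obtain ⟨e, hei, hec⟩ := Fin.exists_ne_and_ne_of_two_lt i c hd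
  have hbox : β ^ (d * m) ≤ (fkLaw R (restrW (↑R : Set (Site d)) (lattW d p)) q).real
      (openConnIn (↑R : Set (Site d)) x1 t) :=
    le_fkLaw_restrW_real_openConnIn_of_subbox hq p hIsub x1 t
      (pow_le_fkLaw_Icc_real_openConnIn_slabBox hq p hd2 hβ0 hβ1 hβ loI hiI c i e hei.symm hci.symm hec hwideI N
        hfatI m hx1I htI' hdc hdist)
  have hπ0 : 0 ≤ (p : ℝ) / (p + q * (1 - p)) := div_nonneg p.2.1 (by nlinarith [p.2.1, p.2.2, hq0])
  exact mul_le_fkLaw_real_openConnIn_trans R _ hq (↑R : Set (Site d)) z x1 t hπ0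
    (ratio_le_fkLaw_restrW_real_openConnIn_edge hq p R hzR hx1R hadj) hbox


/-! ### (P1) v5 — FACE BOXES: the part of the look box beyond a face of the level box, inside the lane slab

`B = Icc lo hi` with `lo_c = ζ - L`, `hi_c = ζ + L` (slab), `[lo_f, hi_f] = [aF, bF]` an interval of `f`-coordinates
at or beyond the face `(f, τ)` of the level box and inside the `f`-range of `U = v + ℓQ_g`, and the full `U`-range
in every other direction. Such a box is unfrozen (`S ⊆ Icc (Lo+1) (Hi-1)`), hence inside every lane region. -/

/-- A face box lies in every lane region of its slab. [folklore] -/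
theorem faceBox_subset_laneRegion {Lo Hi v : Site d} {S : Finset (Site d)} (hS : S ⊆ Finset.Icc (Lo + 1) (Hi - 1))
    {f c : Fin d} (hfc : f ≠ c) {τf yf : ℤ} (hfaceF : (τf = 1 ∧ yf = Hi f) ∨ (τf = -1 ∧ yf = Lo f))
    {ℓ : ℕ} {g : Geom d} {ζ : ℤ} {L : ℕ} (hslabQ : v c + ℓ * g.loQ c ≤ ζ - L ∧ ζ + L ≤ v c + ℓ * g.hiQ c)
    {aF bF : ℤ} (haF : v f + ℓ * g.loQ f ≤ aF) (hbF : bF ≤ v f + ℓ * g.hiQ f)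
    (hout : ∀ w : ℤ, aF ≤ w → w ≤ bF → 0 ≤ τf * (w - yf)) (z w : Site d) :
    Finset.Icc (fun b => if b = c then ζ - L else if b = f then aF else v b + ℓ * g.loQ b)
        (fun b => if b = c then ζ + L else if b = f then bF else v b + ℓ * g.hiQ b) ⊆
      ((g.Qset ℓ v).filter fun x => |x c - ζ| ≤ (L : ℤ)) \ (S \ {z, w}) := by
  intro x hx
  rw [mem_Icc_iff] at hx
  have hxc : |x c - ζ| ≤ (L : ℤ) := by
    have := hx c; simp only [if_true] at this; rw [abs_le]; constructor <;> linarith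
  have hxf := hx f
  simp only [if_neg hfc, if_true] at hxf
  refine mem_laneRegion (mem_Qset_of_forall fun b => ?_) hxc (Or.inl (not_mem_of_face hS hfaceF (hout _ hxf.1 hxf.2)))
  by_cases hbc : b = c
  · rw [hbc]; rw [abs_le] at hxc; constructor <;> linarith [hslabQ.1, hslabQ.2]
  · by_cases hbf : b = f
    · rw [hbf]; exact ⟨haF.trans hxf.1, hxf.2.trans hbF⟩
    · have := hx b; simp only [if_neg hbc, if_neg hbf] at this; exact this

/-- Membership in a face box, coordinatewise. [folklore] -/
theorem mem_faceBox {v : Site d} {f c : Fin d} {ℓ : ℕ} {g : Geom d} {ζ : ℤ} {L : ℕ} {aF bF : ℤ}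
    {x : Site d} (hxc : ζ - L ≤ x c ∧ x c ≤ ζ + L) (hxf : aF ≤ x f ∧ x f ≤ bF)
    (hxb : ∀ b, b ≠ c → b ≠ f → v b + ℓ * g.loQ b ≤ x b ∧ x b ≤ v b + ℓ * g.hiQ b) :
    x ∈ Finset.Icc (fun b => if b = c then ζ - L else if b = f then aF else v b + ℓ * g.loQ b)
        (fun b => if b = c then ζ + L else if b = f then bF else v b + ℓ * g.hiQ b) := by
  rw [mem_Icc_iff]; intro b
  by_cases hbc : b = c
  · simp only [if_pos hbc]; rw [hbc]; exact hxc
  · by_cases hbf : b = f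
    · simp only [if_neg hbc, if_pos hbf]; rw [hbf]; exact hxf
    · simp only [if_neg hbc, if_neg hbf]; exact hxb b hbc hbf

/-- Widths of a face box: `≥ 2K` off the slab direction when `aF + 2K ≤ bF` and `K ≤ ℓ`; `≥ 2L` in the slab
direction. [folklore] -/
theorem faceBox_wide {v : Site d} {f c : Fin d} {ℓ : ℕ} {g : Geom d}
    (hloQ : ∀ b, g.loQ b ≤ -1) (hhiQ : ∀ b, 1 ≤ g.hiQ b) {ζ : ℤ} {L : ℕ} {aF bF : ℤ} {K : ℕ}
    (hK : aF + 2 * (K : ℤ) ≤ bF) (hKℓ : K ≤ ℓ) (hKL : L ≤ K) :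
    (∀ b, (fun b => if b = c then ζ - L else if b = f then aF else v b + ℓ * g.loQ b) b + 2 * (L : ℤ) ≤
      (fun b => if b = c then ζ + L else if b = f then bF else v b + ℓ * g.hiQ b) b) ∧
    (∀ b, b ≠ c → (fun b => if b = c then ζ - L else if b = f then aF else v b + ℓ * g.loQ b) b + 2 * (K : ℤ) ≤
      (fun b => if b = c then ζ + L else if b = f then bF else v b + ℓ * g.hiQ b) b) := by
  have hℓ0 : (0 : ℤ) ≤ ℓ := Nat.cast_nonneg ℓ
  have hA : ∀ b, (ℓ : ℤ) * g.loQ b ≤ -ℓ := fun b => by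
    have := mul_le_mul_of_nonneg_left (hloQ b) hℓ0; linarith
  have hB : ∀ b, (ℓ : ℤ) ≤ ℓ * g.hiQ b := fun b => by
    have := mul_le_mul_of_nonneg_left (hhiQ b) hℓ0; linarith
  have hKℓ' : (K : ℤ) ≤ ℓ := by exact_mod_cast hKℓ
  have hKL' : (L : ℤ) ≤ K := by exact_mod_cast hKL
  constructor
  · intro b
    by_cases hbc : b = c
    · simp only [if_pos hbc]; linarith
    · by_cases hbf : b = f
      · simp only [if_neg hbc, if_pos hbf]; linarith
      · simp only [if_neg hbc, if_neg hbf]; linarith [hA b, hB b]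
  · intro b hbc
    by_cases hbf : b = f
    · simp only [if_neg hbc, if_pos hbf]; exact hK
    · simp only [if_neg hbc, if_neg hbf]; linarith [hA b, hB b]

end Summit.CriticalPhenomena.PercolationContinuityZ3.Theorems.FK

end
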